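import Summits.HodgeConjecture.HodgeConjecture.Theorems.F0P3HolFormGenClasses
import Summits.HodgeConjecture.HodgeConjecture.Theorems.F0P3GenClosureKFinite
import Summits.HodgeConjecture.HodgeConjecture.Theorems.F0P3HolFormClosedSubrep
import Summits.HodgeConjecture.HodgeConjecture.Theorems.F0P3ArchIsotypyOfIrreducibleCore
import Literature.NumberTheory.Automorphic.GKModulesOneParameter
import HarnessLib

/-!
# Crux `H413` — RUNG 1½ «ISOTYPY FROM A NULL CORE», brick B5c: LETTER F1a AT THE CM PIN FOR A HOLOMORPHIC-TYPE `P`, modulo the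
# `K`-irreducibility of the cotangent `K`-type and the admissibility of `gen`

Floor-0 programme P3 «U3-mult», seat F0P3-p02 (g3); crux item stmt-HodgeConjecture-24833 (`HCCMUnconditional.H413`); road doc
`F0/P3/F0P3-p02/ROAD-F1a-inhouse.F0P3p02g3.md`.  HC_CM is proved only modulo the printed citations until rung 0 closes.

Setting: the CM frame `(L, ι, H, T, hT)` with `H` definite away from `ι` and `[L⁺:ℚ] ≥ 2` (compact quotient, ★ `compactSpace_automorphicQuotient_cm`),
automorphic `μ`, discrete `P`, `Φ ∈ holCotForms (cmArchSection …) (cmCompactFactor …)`, `S(Φ)` p01's Lie-stable span and `C_Φ` the `L²`-closure of its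
classes (★ B3-CM `holClosure_package`, read through ★ B4b `lieSpan_eq_span_iterLieDeriv`); `(ρK, ρ𝔤) = (P.archRepKCM, P.archRepLieCM) ι T hT`.

* §1 (generic, `(α, β) = (Fin 2, Fin 1)`, any `(ρK, ρ𝔤)`) `mem_span_range_iff_exists_valueMap`, `nullCore_of_valueMap` — the span `E` of the two frame
  vectors of a value map `φ(Y) = ∑ⱼ Y_{(inl j)(inr 0)} • vⱼ` IS `φ(𝔤)`; from the conclusions (hK) (h𝔨) (hwt) (hN) of ★ `valueMap_hol` it is a null core:
  `z₀ = i` on `E`, `P_I(x_s) E = 0`, `𝔨 E ⊆ E`, `K E ⊆ E`; and `φ ≠ 0 → E ≠ ⊥`.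
* §2 `exists_closedSubrep_hol` — `C_Φ ∩ P` as a CLOSED `P|_{U(2,1)}`-INVARIANT SUBSPACE `W_Φ : ClosedSubrep (P.archRepCM ι T hT)` (B3-CM (1) through the
  frame ★ `coe_archRepCM_apply_u21FrameEquivFin1`).
* §3 `mem_gen_of_coe_mem_holClosure` — **the smooth `K`-finite vectors of `C_Φ` lie in `gen`** (B4a ★ `mem_gen_of_mem_closure_of_finite` with `F` the
  `K`-orbit span: finite-dimensional by `kFinite`, `z₀`-stable by ★ `IsGKModule.apply_mem_of_expK_stable`, inside `C_Φ` = closure of the image of `gen`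
  by ★ B4b `l2OfForms_eq_map_gen`).
* §4 **`archIsotypy_of_hol`** — LETTER F1a `P.ArchIsotypy (uFormGroup (Fin 2) (Fin 1)) (cmArchSectionUForm L ι H T hT)` for `P` CONTAINING a non-zero
  holomorphic cotangent form, from ★ B5b `F0P3ArchIsotypyOfIrreducibleCore.archIsotypy_of_core'` (F0P3-p01 (g4), over ★ B5a translate detection) with
  `W := W_Φ`, whose Harish-Chandra core IS `gen` (`§3` and ★ B4b `coe_mem_l2OfForms_of_mem_gen`), irreducibility by ★ B1 `eq_bot_or_eq_gen_of_isGKSubmodule`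
  — MODULO two hypotheses kept explicit: (a) `hEirr`, the `K`-irreducibility of `span {v₀, v₁}` (the cotangent `K`-type), (b) `hadm`, the admissibility
  of `ρK|_gen` (both taken by F0P3-p03 (g4), `F0P3GenAdmissible`).

No definition, no sorry, no named fact; `--supports stmt-HodgeConjecture-24833 --as helper`.

References: [HarishChandra1953] Thms. 4–6, §9; [BorelWallach2000] 0 §2.4–2.5, II §4.1, VII 3.2; [FlathCorvallis1979] Thm. 3–4;
[BorelJacquetCorvallis1979] §4.3, §4.6; [Dixmier1977] §13.1.2; [Rogawski1990] Prop. 15.2.1 (b).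
-/

set_option linter.dupNamespace false

-- Mathlib idiom (Mathlib/Algebra/Lie/OfAssociative.lean; as in ★ `F0P3bPNullGeneration`, ★ `F0P3GenIrreducibleOfUnitary`): the commutator bracket on
-- `Module.End ℂ V`, needed to mention `pOp` and `(uFormGroup α β).lie →ₗ⁅ℝ⁆ Module.End ℂ V`.
attribute [local instance 100] LieRing.ofAssociativeRing

open scoped Matrix MatrixGroups Topology InnerProductSpace ENNReal ComplexConjugate ComplexOrder
open MeasureTheory NumberField Filter

namespace Summit.HodgeConjecture.HodgeConjecture.Cruxes.H413.F0P3HolFormArchIsotypy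

open Literature.NumberTheory.Automorphic Literature.NumberTheory.Automorphic.UnitaryGroup
open Literature.NumberTheory.Automorphic.UnitaryGroup.CotangentForms
open Literature.RepresentationTheory.KonnoKonno2007 Literature.RepresentationTheory.KonnoKonno2007.RealDualPair
open Literature.RepresentationTheory.BorelWallach2000
open Literature.Geometry.ComplexHyperbolic.BallModel (U21 J)
open Literature.AlgebraicGeometry.ShimuraVarieties.BallForms (u21Group liePMat)
open Summit.HodgeConjecture.HodgeConjecture.Cruxes.H413.F0P3CotangentFormL2Span
open Summit.HodgeConjecture.HodgeConjecture.Cruxes.H413.F0P3CotangentFormValueMap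
open Summit.HodgeConjecture.HodgeConjecture.Cruxes.H413.F0P3ValueMapOfFrameVectors (exists_valueMap valueMap_apply_upqUnit)
open Summit.HodgeConjecture.HodgeConjecture.Cruxes.H413.F0P3HolProjectionReduction (compactSpace_automorphicQuotient_cm)
open Summit.HodgeConjecture.HodgeConjecture.Cruxes.H413.F0P3bPPartOperators
open Summit.HodgeConjecture.HodgeConjecture.Cruxes.H413.F0P3bPNullGeneration
open Summit.HodgeConjecture.HodgeConjecture.Cruxes.H413.F0P3GenIrreducibleOfUnitary
open Summit.HodgeConjecture.HodgeConjecture.Cruxes.H413.F0P3GenClosureKFinite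
open Summit.HodgeConjecture.HodgeConjecture.Cruxes.H413.F0P3HolFormGenClasses
open Summit.HodgeConjecture.HodgeConjecture.Cruxes.H413.F0P3HolFormClosedSubrep
open Summit.HodgeConjecture.HodgeConjecture.Cruxes.H413.F0P3ArchIsotypyOfIrreducibleCore

/-! ## §1 (generic) The span of the frame vectors of a typed value map is a null core -/

section Generic

variable {V : Type} [AddCommGroup V] [Module ℂ V]
  {ρK : Representation ℂ (uFormGroup (Fin 2) (Fin 1)).maximalCompact V} {ρ𝔤 : (uFormGroup (Fin 2) (Fin 1)).lie →ₗ⁅ℝ⁆ Module.End ℂ V}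

/-- The span of the frame vectors `v₀, v₁` is exactly the image of the value map `φ(Y) = ∑ⱼ Y_{(inl j)(inr 0)} • vⱼ` (`φ (X_{c E_{j,0}}) = c • vⱼ`,
★ `valueMap_apply_upqUnit`). [cite: BorelWallach2000, VI 4.8 (3)] -/
theorem mem_span_range_iff_exists_valueMap (v : Fin 2 → V) (φ : (uFormGroup (Fin 2) (Fin 1)).lie →ₗ[ℝ] V)
    (hφ : ∀ Y : (uFormGroup (Fin 2) (Fin 1)).lie,
      φ Y = ∑ j : Fin 2, ((Y : Matrix (Fin 2 ⊕ Fin 1) (Fin 2 ⊕ Fin 1) ℂ) (Sum.inl j) (Sum.inr 0)) • v j)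
    {e : V} : e ∈ Submodule.span ℂ (Set.range v) ↔ ∃ Y, φ Y = e := by
  have hφ' : ∀ Y : (uFormGroup (Fin 2) (Fin 1)).lie, φ Y = ∑ j : Fin 2,
      LinearMap.id (R := ℝ) ((Y : Matrix (Fin 2 ⊕ Fin 1) (Fin 2 ⊕ Fin 1) ℂ) (Sum.inl j) (Sum.inr 0)) • v j := hφ
  constructor
  · intro he
    obtain ⟨c, rfl⟩ := (Submodule.mem_span_range_iff_exists_fun ℂ).1 he
    refine ⟨∑ j : Fin 2, upqUnit (j, (0 : Fin 1)) (c j), ?_⟩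
    rw [map_sum]
    exact Finset.sum_congr rfl fun j _ => valueMap_apply_upqUnit LinearMap.id v φ hφ' (j, 0) (c j)
  · rintro ⟨Y, rfl⟩
    rw [hφ Y]
    exact Submodule.sum_mem _ fun j _ => Submodule.smul_mem _ _ (Submodule.subset_span ⟨j, rfl⟩)

/-- **The span of the frame vectors of a typed value map is a NULL CORE.**  From the conclusions (hK) (h𝔨) (hwt) (hN) of ★ `valueMap_hol` (the `φp`-binders
of ★ `not_both_types_of_detected`): on `E = span {v₀, v₁}`, `z₀` acts by `i`, the operators `P_i(x_s) = ρ𝔤(x_s) + i ρ𝔤(⁅z₀, x_s⁆)` vanish, and `E` is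
stable under `𝔨` and `K` — the binders `hw ∕ hEn ∕ hEk ∕ hEK` of ★ B1 `eq_bot_or_eq_gen_of_isGKSubmodule` and ★ B4; moreover `φ ≠ 0 → E ≠ ⊥`.
[cite: BorelWallach2000, II §4.1–4.2 and VI 4.8] [cite: Rogawski1990, Prop. 15.2.1 (b)] -/
theorem nullCore_of_valueMap (v : Fin 2 → V) (φ : (uFormGroup (Fin 2) (Fin 1)).lie →ₗ[ℝ] V)
    (hφ : ∀ Y : (uFormGroup (Fin 2) (Fin 1)).lie,
      φ Y = ∑ j : Fin 2, ((Y : Matrix (Fin 2 ⊕ Fin 1) (Fin 2 ⊕ Fin 1) ℂ) (Sum.inl j) (Sum.inr 0)) • v j)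
    (hK : ∀ (k : (uFormGroup (Fin 2) (Fin 1)).maximalCompact) (X : (uFormGroup (Fin 2) (Fin 1)).lie),
      ρK k (φ X) = φ ((uFormGroup (Fin 2) (Fin 1)).Ad (Subgroup.inclusion (uFormGroup (Fin 2) (Fin 1)).maximalCompact_le_carrier k) X))
    (hk : ∀ W ∈ (uFormGroup (Fin 2) (Fin 1)).kInLie, ∀ X : (uFormGroup (Fin 2) (Fin 1)).lie, φ ⁅W, X⁆ = ρ𝔤 W (φ X))
    (hwt : ∀ X : (uFormGroup (Fin 2) (Fin 1)).lie, ρ𝔤 (upqZ0 (Fin 2) (Fin 1)) (φ X) = Complex.I • φ X)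
    (hN : ∀ (X : (uFormGroup (Fin 2) (Fin 1)).lie) (s : (Fin 2 × Fin 1) × Fin 2),
      ρ𝔤 (upqPBasis s) (φ X) + Complex.I • ρ𝔤 ⁅upqZ0 (Fin 2) (Fin 1), upqPBasis s⁆ (φ X) = 0) :
    (∀ e ∈ Submodule.span ℂ (Set.range v), ρ𝔤 (upqZ0 (Fin 2) (Fin 1)) e = Complex.I • e) ∧
    (∀ e ∈ Submodule.span ℂ (Set.range v), ∀ s : (Fin 2 × Fin 1) × Fin 2, pOp ρ𝔤 Complex.I (upqPBasis s) e = 0) ∧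
    (∀ W ∈ (uFormGroup (Fin 2) (Fin 1)).kInLie, ∀ e ∈ Submodule.span ℂ (Set.range v), ρ𝔤 W e ∈ Submodule.span ℂ (Set.range v)) ∧
    (∀ (k : (uFormGroup (Fin 2) (Fin 1)).maximalCompact), ∀ e ∈ Submodule.span ℂ (Set.range v), ρK k e ∈ Submodule.span ℂ (Set.range v)) ∧
    (φ ≠ 0 → Submodule.span ℂ (Set.range v) ≠ ⊥) := by
  have hmem : ∀ {e : V}, e ∈ Submodule.span ℂ (Set.range v) ↔ ∃ Y, φ Y = e := mem_span_range_iff_exists_valueMap v φ hφ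
  refine ⟨fun e he => ?_, fun e he s => ?_, fun W hW e he => ?_, fun k e he => ?_, fun hφ0 hbot => hφ0 ?_⟩
  · obtain ⟨Y, rfl⟩ := hmem.1 he
    exact hwt Y
  · obtain ⟨Y, rfl⟩ := hmem.1 he
    rw [pOp_apply]
    exact hN Y s
  · obtain ⟨Y, rfl⟩ := hmem.1 he
    exact hmem.2 ⟨⁅W, Y⁆, hk W hW Y⟩
  · obtain ⟨Y, rfl⟩ := hmem.1 he
    exact hmem.2 ⟨_, (hK k Y).symm⟩
  · ext Y
    have : φ Y ∈ Submodule.span ℂ (Set.range v) := hmem.2 ⟨Y, rfl⟩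
    rw [hbot, Submodule.mem_bot] at this
    rw [this, LinearMap.zero_apply]

end Generic

/-! ## §2 `C_Φ ∩ P` as a closed `P|_{U(2,1)}`-invariant subspace -/

variable {L : Type} [Field L] [NumberField L] [IsCMField L] (ι : L →+* ℂ) {H : Matrix (Fin 3) (Fin 3) L}
  (T : GL (Fin 3) ℂ) (hT : (T : Matrix (Fin 3) (Fin 3) ℂ)ᴴ * H.map ι * (T : Matrix (Fin 3) (Fin 3) ℂ) = J)

/-- **`W_Φ := C_Φ ∩ P` is a CLOSED `P|_{U(2,1)}`-INVARIANT SUBSPACE** (`ClosedSubrep (P.archRepCM ι T hT)`): closed as the preimage of the closed `C_Φ` under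
`P ↪ L²`, invariant because `P.archRepCM (u21FrameEquivFin1 u) = R(cmArchSection u)` (★ `coe_archRepCM_apply_u21FrameEquivFin1`) and `C_Φ` is
`R(cmArchSection u)`-invariant (★ B3-CM `holClosure_package` (1)). [cite: HarishChandraTAMS1953, Cor. to Thm 2] [cite: BorelWallach2000, VII 3.2]
[cite: Dixmier1977, §13.1.2] -/
theorem exists_closedSubrep_hol
    (hdef : ∀ τ' : L →+* ℂ, InfinitePlace.mk τ' ≠ InfinitePlace.mk ι → (H.map τ').PosDef) (h2 : 2 ≤ Module.finrank ℚ ↥(maximalRealSubfield L))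
    (μ : Measure (adelicGroupData (↥(maximalRealSubfield L)) L (IsCMField.complexConj L) 3 H).automorphicQuotient)
    [(adelicGroupData (↥(maximalRealSubfield L)) L (IsCMField.complexConj L) 3 H).IsAutomorphicMeasure μ]
    (P : DiscreteAutomorphicRep (adelicGroupData (↥(maximalRealSubfield L)) L (IsCMField.complexConj L) 3 H) μ)
    {Φ : (adelicGroupData (↥(maximalRealSubfield L)) L (IsCMField.complexConj L) 3 H).Adelic → (Fin 2 → ℂ)}
    (hΦ : Φ ∈ holCotForms (↥(maximalRealSubfield L)) L (IsCMField.complexConj L) 3 H (cmArchSection L ι H T hT) (cmCompactFactor L ι H T hT))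
    (hPΦ : P.ContainsForm Φ) :
    ∃ W : ContRepresentation.ClosedSubrep (P.archRepCM ι T hT), ∀ y : P.space.toSubmodule, y ∈ W ↔
      (y : (adelicGroupData (↥(maximalRealSubfield L)) L (IsCMField.complexConj L) 3 H).L2 μ) ∈
        (l2OfForms (adelicGroupData (↥(maximalRealSubfield L)) L (IsCMField.complexConj L) 3 H) μ
          (Submodule.span ℂ (Set.range fun p : List u21Group.lie × Fin 2 =>
            iterLieDeriv (H := u21Group) (cmArchSection L ι H T hT) p.1 fun x => Φ x p.2))).topologicalClosure := by
  have hm : ∀ j : Fin 2, MemLp (toQuotFun (adelicGroupData (↥(maximalRealSubfield L)) L (IsCMField.complexConj L) 3 H) fun x => Φ x j) 2 μ :=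
    fun j => let ⟨h, _⟩ := hPΦ j; h
  obtain ⟨h1, -, -⟩ := holClosure_package L ι H T hT hdef h2 μ hΦ hm
  rw [lieSpan_eq_span_iterLieDeriv ι T hT hΦ] at h1
  refine ⟨{ toSubmodule := Submodule.comap P.space.toSubmodule.subtype
              (l2OfForms (adelicGroupData (↥(maximalRealSubfield L)) L (IsCMField.complexConj L) 3 H) μ
                (Submodule.span ℂ (Set.range fun p : List u21Group.lie × Fin 2 =>
                  iterLieDeriv (H := u21Group) (cmArchSection L ι H T hT) p.1 fun x => Φ x p.2))).topologicalClosure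
            apply_mem_toSubmodule := fun g y hy => ?_
            isClosed' := (Submodule.isClosed_topologicalClosure _).preimage continuous_subtype_val }, fun y => Iff.rfl⟩
  obtain ⟨u, rfl⟩ : ∃ u : U21, g = u21FrameEquivFin1 u := ⟨u21FrameEquivFin1.symm g, (u21FrameEquivFin1.apply_symm_apply g).symm⟩
  refine Submodule.mem_comap.2 ?_
  have hrep : ContRepresentation.toRepresentation _ _ _ (P.archRepCM ι T hT) (u21FrameEquivFin1 u) y =
      P.archRepCM ι T hT (u21FrameEquivFin1 u) y := rfl
  rw [hrep, Submodule.coe_subtype, P.coe_archRepCM_apply_u21FrameEquivFin1 ι T hT u y]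
  exact (h1 u _).1 (Submodule.mem_comap.1 hy)


/-! ## §3 The smooth `K`-finite vectors of `C_Φ` lie in `gen` -/

/-- Unitarity of the archimedean module in the currency of ★ B1 ∕ B4a (inner products on `P.archModuleCM ι T hT` itself):
`⟪X·a, b⟫ + ⟪a, X·b⟫ = 0` (★ `inner_archRepLieCM_add_inner_archRepLieCM_eq_zero`). [cite: BorelWallach2000, 0 §2.5] -/
theorem inner_archRepLieCM_skew
    {μ : Measure (adelicGroupData (↥(maximalRealSubfield L)) L (IsCMField.complexConj L) 3 H).automorphicQuotient}
    [(adelicGroupData (↥(maximalRealSubfield L)) L (IsCMField.complexConj L) 3 H).IsAutomorphicMeasure μ]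
    (P : DiscreteAutomorphicRep (adelicGroupData (↥(maximalRealSubfield L)) L (IsCMField.complexConj L) 3 H) μ)
    (X : (uFormGroup (Fin 2) (Fin 1)).lie) (a b : P.archModuleCM ι T hT) :
    ⟪P.archRepLieCM ι T hT X a, b⟫_ℂ + ⟪a, P.archRepLieCM ι T hT X b⟫_ℂ = 0 := by
  rw [Submodule.coe_inner, Submodule.coe_inner]
  exact P.inner_archRepLieCM_add_inner_archRepLieCM_eq_zero ι T hT X a b

set_option maxHeartbeats 400000 in
/-- **Every smooth `K`-finite vector of `P` whose class lies in `C_Φ` belongs to `gen`** (`gen = gen ρ𝔤 i (span {v₀, v₁})` for the coordinate classes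
`vⱼ` of `Φ` and a null core `span {v₀, v₁}`): B4a ★ `mem_gen_of_mem_closure_of_finite` applied to the `K`-orbit span `F` of the vector — finite-dimensional
(`kFinite`), `z₀`-stable (★ `IsGKModule.apply_mem_of_expK_stable`, `z₀ ∈ 𝔨`), and inside `C_Φ`, which is the closure of the image of `gen` (★ B4b
`l2OfForms_eq_map_gen`; `W_Φ` is `K`-stable, ★ B5b `core_le_comap_archRepK`; closures along the closed embedding `P ↪ L²`).
[cite: HarishChandra1953, §9] [cite: BorelWallach2000, 0 §2.4–2.5 and II §4.1] -/
theorem mem_gen_of_coe_mem_holClosure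
    (hdef : ∀ τ' : L →+* ℂ, InfinitePlace.mk τ' ≠ InfinitePlace.mk ι → (H.map τ').PosDef) (h2 : 2 ≤ Module.finrank ℚ ↥(maximalRealSubfield L))
    (μ : Measure (adelicGroupData (↥(maximalRealSubfield L)) L (IsCMField.complexConj L) 3 H).automorphicQuotient)
    [(adelicGroupData (↥(maximalRealSubfield L)) L (IsCMField.complexConj L) 3 H).IsAutomorphicMeasure μ]
    (P : DiscreteAutomorphicRep (adelicGroupData (↥(maximalRealSubfield L)) L (IsCMField.complexConj L) 3 H) μ)
    {Φ : (adelicGroupData (↥(maximalRealSubfield L)) L (IsCMField.complexConj L) 3 H).Adelic → (Fin 2 → ℂ)}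
    (hΦ : Φ ∈ holCotForms (↥(maximalRealSubfield L)) L (IsCMField.complexConj L) 3 H (cmArchSection L ι H T hT) (cmCompactFactor L ι H T hT))
    (hPΦ : P.ContainsForm Φ) (v : Fin 2 → P.archModuleCM ι T hT)
    (hv : ∀ j : Fin 2, ∃ hm : MemLp (toQuotFun (adelicGroupData (↥(maximalRealSubfield L)) L (IsCMField.complexConj L) 3 H) fun x => Φ x j) 2 μ,
      (((v j : P.archModuleCM ι T hT) : P.space.toSubmodule) : (adelicGroupData (↥(maximalRealSubfield L)) L (IsCMField.complexConj L) 3 H).L2 μ) =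
        hm.toLp _)
    (hEn : ∀ e ∈ Submodule.span ℂ (Set.range v), ∀ s : (Fin 2 × Fin 1) × Fin 2,
      pOp (P.archRepLieCM ι T hT) Complex.I (upqPBasis s) e = 0)
    (hEk : ∀ W ∈ (uFormGroup (Fin 2) (Fin 1)).kInLie, ∀ e ∈ Submodule.span ℂ (Set.range v), P.archRepLieCM ι T hT W e ∈ Submodule.span ℂ (Set.range v))
    (hEK : ∀ (k : (uFormGroup (Fin 2) (Fin 1)).maximalCompact), ∀ e ∈ Submodule.span ℂ (Set.range v),
      P.archRepKCM ι T hT k e ∈ Submodule.span ℂ (Set.range v))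
    {w : ℂ} (hw : ∀ e ∈ Submodule.span ℂ (Set.range v), P.archRepLieCM ι T hT (upqZ0 (Fin 2) (Fin 1)) e = w • e)
    {x : P.archModuleCM ι T hT}
    (hx : ((x : P.space.toSubmodule) : (adelicGroupData (↥(maximalRealSubfield L)) L (IsCMField.complexConj L) 3 H).L2 μ) ∈
      (l2OfForms (adelicGroupData (↥(maximalRealSubfield L)) L (IsCMField.complexConj L) 3 H) μ
        (Submodule.span ℂ (Set.range fun p : List u21Group.lie × Fin 2 =>
          iterLieDeriv (H := u21Group) (cmArchSection L ι H T hT) p.1 fun x => Φ x p.2))).topologicalClosure) :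
    x ∈ gen (P.archRepLieCM ι T hT) Complex.I (Submodule.span ℂ (Set.range v)) := by
  haveI := compactSpace_automorphicQuotient_cm hdef h2
  have hv' : ∀ j : Fin 2, (((v j : P.archModuleCM ι T hT) : P.space.toSubmodule) : (adelicGroupData (↥(maximalRealSubfield L)) L (IsCMField.complexConj L) 3 H).L2 μ) =
      (memLp_toQuotFun_apply ι T hT (μ := μ) hΦ j).toLp (toQuotFun (adelicGroupData (↥(maximalRealSubfield L)) L (IsCMField.complexConj L) 3 H) fun x => Φ x j) :=
    fun j => by obtain ⟨hm, h⟩ := hv j; exact h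
  have hGK := P.isGKModule_archModuleCM ι T hT
  haveI : FiniteDimensional ℂ (Submodule.span ℂ (Set.range v)) := FiniteDimensional.span_of_finite ℂ (Set.finite_range v)
  obtain ⟨W, hW⟩ := exists_closedSubrep_hol ι T hT hdef h2 μ P hΦ hPΦ
  have hxW : (x : P.space.toSubmodule) ∈ W := (hW _).2 hx
  -- the `K`-orbit span of `x`
  let F : Submodule ℂ (P.archModuleCM ι T hT) :=
    Submodule.span ℂ (Set.range fun k : (uFormGroup (Fin 2) (Fin 1)).maximalCompact => P.archRepKCM ι T hT k x)
  haveI : FiniteDimensional ℂ F := hGK.kFinite x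
  have hxF : x ∈ F := Submodule.subset_span ⟨1, by simp only [map_one, Module.End.one_apply]⟩
  have hFK : ∀ (k : (uFormGroup (Fin 2) (Fin 1)).maximalCompact), ∀ u ∈ F, P.archRepKCM ι T hT k u ∈ F := by
    intro k u hu
    have hle : F.map (P.archRepKCM ι T hT k) ≤ F := by
      rw [Submodule.map_span]
      refine Submodule.span_le.2 ?_
      rintro _ ⟨_, ⟨k', rfl⟩, rfl⟩
      exact Submodule.subset_span ⟨k * k', by simp only [map_mul, Module.End.mul_apply]⟩
    exact hle ⟨u, hu, rfl⟩
  -- `z₀`-stability of `F` (`z₀ ∈ 𝔨`)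
  obtain ⟨Z, hZ⟩ := (LieHom.mem_range _ _).1 (upqZ0_mem_kInLie : upqZ0 (Fin 2) (Fin 1) ∈ (uFormGroup (Fin 2) (Fin 1)).kInLie)
  have hFz : ∀ u ∈ F, P.archRepLieCM ι T hT (upqZ0 (Fin 2) (Fin 1)) u ∈ F := by
    intro u hu
    rw [← hZ]
    exact hGK.apply_mem_of_expK_stable Z (fun t u hu => hFK _ u hu) hu
  -- `F ⊆ W_Φ ⊆` closure of the image of `gen`
  have hFW : F ≤ W.toSubmodule.comap (P.archModuleCM ι T hT).subtype :=
    Submodule.span_le.2 (by rintro _ ⟨k, rfl⟩; exact core_le_comap_archRepK P _ _ W k hxW)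
  have himg : (l2OfForms (adelicGroupData (↥(maximalRealSubfield L)) L (IsCMField.complexConj L) 3 H) μ
        (Submodule.span ℂ (Set.range fun p : List u21Group.lie × Fin 2 =>
          iterLieDeriv (H := u21Group) (cmArchSection L ι H T hT) p.1 fun x => Φ x p.2)) :
        Set ((adelicGroupData (↥(maximalRealSubfield L)) L (IsCMField.complexConj L) 3 H).L2 μ)) =
      Subtype.val '' (((gen (P.archRepLieCM ι T hT) Complex.I (Submodule.span ℂ (Set.range v))).map (P.archModuleCM ι T hT).subtype :
        Submodule ℂ P.space.toSubmodule) : Set P.space.toSubmodule) := by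
    rw [l2OfForms_eq_map_gen ι T hT P hΦ v hv' hEn hEk hEK, Submodule.map_comp, Submodule.map_coe]
    rfl
  have hFC : ∀ u ∈ F, ((u : P.archModuleCM ι T hT) : P.space.toSubmodule) ∈
      ((gen (P.archRepLieCM ι T hT) Complex.I (Submodule.span ℂ (Set.range v))).map (P.archModuleCM ι T hT).subtype).topologicalClosure := by
    intro u hu
    have huC := (hW _).1 (hFW hu)
    rw [← SetLike.mem_coe, Submodule.topologicalClosure_coe, Topology.IsEmbedding.subtypeVal.closure_eq_preimage_closure_image,
      Set.mem_preimage, ← himg, ← Submodule.topologicalClosure_coe]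
    exact huC
  exact mem_gen_of_mem_closure_of_finite (inner_archRepLieCM_skew ι T hT P) Complex.I_mul_I hw hFz hFC hxF


/-! ## §4 Letter F1a at the CM pin for a holomorphic-type `P`, modulo the `K`-type and admissibility -/

/-- **LETTER F1a AT THE CM PIN FOR `P` CONTAINING A NON-ZERO HOLOMORPHIC COTANGENT FORM** — `P.ArchIsotypy (uFormGroup (Fin 2) (Fin 1))
(cmArchSectionUForm L ι H T hT)` BY NAME (★ p797762's named fact, here PROVED for such `P` in the compact CM setting) — **modulo** (a) `hEirr`: the
`K`-irreducibility of the span of the two coordinate classes `v₀, v₁ ∈ P.archModuleCM ι T hT` of `Φ` (the cotangent `K`-type `ℂ²` of `U(2) × U(1)`),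
and (b) `hadm`: the admissibility of `K` on `gen ρ𝔤 i (span {v₀, v₁})`; both quantified over every choice of coordinate classes (★ `exists_vectors`).
Assembly: `W := W_Φ` (`exists_closedSubrep_hol`), non-zero as it contains `[Φⱼ]` (★ B4b `coe_mem_l2OfForms_of_mem_gen`); `U := gen` of the null core
`span {v₀, v₁}` (`nullCore_of_valueMap` on ★ `valueMap_hol`, ★ `isGKSubmodule_gen`) IS the Harish-Chandra core of `W_Φ` (`mem_gen_of_coe_mem_holClosure` and ★ B4b
`coe_mem_l2OfForms_of_mem_gen`); irreducibility in B1's shape (★ `eq_bot_or_eq_gen_of_isGKSubmodule`); then ★ B5b `archIsotypy_of_core'` (translate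
detection ★ B5a).
[cite: HarishChandra1953, Thms. 4–6 and §9] [cite: FlathCorvallis1979, Thm. 3 and Thm. 4] [cite: BorelJacquetCorvallis1979, §4.3 and §4.6]
[cite: BorelWallach2000, 0 §2.4–2.5, II §4.1 and VII 3.2] [cite: Rogawski1990, Prop. 15.2.1 (b)] -/
theorem archIsotypy_of_hol
    (hdef : ∀ τ' : L →+* ℂ, InfinitePlace.mk τ' ≠ InfinitePlace.mk ι → (H.map τ').PosDef) (h2 : 2 ≤ Module.finrank ℚ ↥(maximalRealSubfield L))
    (μ : Measure (adelicGroupData (↥(maximalRealSubfield L)) L (IsCMField.complexConj L) 3 H).automorphicQuotient)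
    [(adelicGroupData (↥(maximalRealSubfield L)) L (IsCMField.complexConj L) 3 H).IsAutomorphicMeasure μ]
    (P : DiscreteAutomorphicRep (adelicGroupData (↥(maximalRealSubfield L)) L (IsCMField.complexConj L) 3 H) μ)
    {Φ : (adelicGroupData (↥(maximalRealSubfield L)) L (IsCMField.complexConj L) 3 H).Adelic → (Fin 2 → ℂ)}
    (hΦ : Φ ∈ holCotForms (↥(maximalRealSubfield L)) L (IsCMField.complexConj L) 3 H (cmArchSection L ι H T hT) (cmCompactFactor L ι H T hT))
    (hΦ0 : Φ ≠ 0) (hPΦ : P.ContainsForm Φ)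
    (hEirr : ∀ v : Fin 2 → P.archModuleCM ι T hT,
      (∀ j : Fin 2, ∃ hm : MemLp (toQuotFun (adelicGroupData (↥(maximalRealSubfield L)) L (IsCMField.complexConj L) 3 H) fun x => Φ x j) 2 μ,
        (((v j : P.archModuleCM ι T hT) : P.space.toSubmodule) : (adelicGroupData (↥(maximalRealSubfield L)) L (IsCMField.complexConj L) 3 H).L2 μ) =
          hm.toLp _) →
      ∀ F : Submodule ℂ (P.archModuleCM ι T hT), F ≤ Submodule.span ℂ (Set.range v) →
        (∀ (k : (uFormGroup (Fin 2) (Fin 1)).maximalCompact), ∀ f ∈ F, P.archRepKCM ι T hT k f ∈ F) → F = ⊥ ∨ F = Submodule.span ℂ (Set.range v))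
    (hadm : ∀ v : Fin 2 → P.archModuleCM ι T hT,
      (∀ j : Fin 2, ∃ hm : MemLp (toQuotFun (adelicGroupData (↥(maximalRealSubfield L)) L (IsCMField.complexConj L) 3 H) fun x => Φ x j) 2 μ,
        (((v j : P.archModuleCM ι T hT) : P.space.toSubmodule) : (adelicGroupData (↥(maximalRealSubfield L)) L (IsCMField.complexConj L) 3 H).L2 μ) =
          hm.toLp _) →
      ∀ (U : Submodule ℂ (P.archModuleCM ι T hT)), U = gen (P.archRepLieCM ι T hT) Complex.I (Submodule.span ℂ (Set.range v)) →
        ∀ hK : ∀ k : (uFormGroup (Fin 2) (Fin 1)).maximalCompact, U ≤ U.comap (P.archRepKCM ι T hT k),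
          @IsAdmissibleGK ℂ _ _ _ _ _ (Fin 2 ⊕ Fin 1) _ _ (uFormGroup (Fin 2) (Fin 1)) ↥U U.addCommGroup U.module
            ((P.archRepKCM ι T hT).subrepresentation U hK)) :
    P.ArchIsotypy (uFormGroup (Fin 2) (Fin 1)) (cmArchSectionUForm L ι H T hT) := by
  haveI := compactSpace_automorphicQuotient_cm hdef h2 (L := L) (ι := ι) (H := H)
  -- the coordinate classes and the value map
  have hP : ∀ j : Fin 2, (memLp_toQuotFun_apply ι T hT (μ := μ) hΦ j).toLp _ ∈ P.space.toSubmodule :=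
    fun j => by obtain ⟨hm, h⟩ := hPΦ j; exact h
  obtain ⟨v, hv⟩ := exists_vectors ι T hT P hΦ hP
  have hv' : ∀ j : Fin 2, ∃ hm : MemLp (toQuotFun (adelicGroupData (↥(maximalRealSubfield L)) L (IsCMField.complexConj L) 3 H) fun x => Φ x j) 2 μ,
      (((v j : P.archModuleCM ι T hT) : P.space.toSubmodule) : (adelicGroupData (↥(maximalRealSubfield L)) L (IsCMField.complexConj L) 3 H).L2 μ) =
        hm.toLp _ := fun j => ⟨_, hv j⟩
  obtain ⟨φ, hφ⟩ := exists_valueMap LinearMap.id v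
  have hφ' : ∀ Y : (uFormGroup (Fin 2) (Fin 1)).lie,
      φ Y = ∑ j : Fin 2, ((Y : Matrix (Fin 2 ⊕ Fin 1) (Fin 2 ⊕ Fin 1) ℂ) (Sum.inl j) (Sum.inr 0)) • v j := hφ
  obtain ⟨-, hK, hk, hwt, hN, hne⟩ := valueMap_hol ι T hT P hΦ v hv φ hφ'
  obtain ⟨hw, hEn, hEk, hEK, hE⟩ := nullCore_of_valueMap (ρK := P.archRepKCM ι T hT) (ρ𝔤 := P.archRepLieCM ι T hT) v φ hφ' hK hk hwt hN
  have hE0 : Submodule.span ℂ (Set.range v) ≠ ⊥ := hE (hne hΦ0)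
  haveI : FiniteDimensional ℂ (Submodule.span ℂ (Set.range v)) := FiniteDimensional.span_of_finite ℂ (Set.finite_range v)
  -- `U := gen`, a `(𝔤, K)`-submodule
  have hU : IsGKSubmodule (P.archRepKCM ι T hT) (P.archRepLieCM ι T hT) (gen (P.archRepLieCM ι T hT) Complex.I (Submodule.span ℂ (Set.range v))) :=
    isGKSubmodule_gen (P.isGKModule_archModuleCM ι T hT).ad_compat hEn hEk hEK
  have hUne : gen (P.archRepLieCM ι T hT) Complex.I (Submodule.span ℂ (Set.range v)) ≠ ⊥ := fun h =>
    hE0 (eq_bot_iff.2 ((le_gen (ρ𝔤 := P.archRepLieCM ι T hT) Complex.I (Submodule.span ℂ (Set.range v))).trans h.le))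
  -- `W := W_Φ`
  obtain ⟨W, hW⟩ := exists_closedSubrep_hol ι T hT hdef h2 μ P hΦ hPΦ
  have hWne : W ≠ ⊥ := by
    obtain ⟨e, he, he0⟩ := (Submodule.ne_bot_iff _).1 hE0
    have heW : (e : P.space.toSubmodule) ∈ W :=
      (hW _).2 (Submodule.le_topologicalClosure _ (coe_mem_l2OfForms_of_mem_gen ι T hT P hΦ v hv (le_gen _ _ he)))
    intro hbot
    rw [hbot, ContRepresentation.ClosedSubrep.mem_bot] at heW
    exact he0 (Subtype.ext heW)
  have hWU : ∀ x : P.archModuleCM ι T hT, (x : P.space.toSubmodule) ∈ W → x ∈ gen (P.archRepLieCM ι T hT) Complex.I (Submodule.span ℂ (Set.range v)) :=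
    fun x hx => mem_gen_of_coe_mem_holClosure ι T hT hdef h2 μ P hΦ hPΦ v hv' hEn hEk hEK hw ((hW _).1 hx)
  have hirr : ∀ U' : Submodule ℂ (P.archModuleCM ι T hT), IsGKSubmodule (P.archRepKCM ι T hT) (P.archRepLieCM ι T hT) U' →
      U' ≤ gen (P.archRepLieCM ι T hT) Complex.I (Submodule.span ℂ (Set.range v)) →
      U' = ⊥ ∨ U' = gen (P.archRepLieCM ι T hT) Complex.I (Submodule.span ℂ (Set.range v)) :=
    by
    -- ★ B1 read in the Submodule currency of ★ B4a (`V` a subspace of the inner-product space `P`): instantiating B1's abstract normed `V`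
    -- directly at the nested subtype `P.archModuleCM ι T hT` does not unify within the default budget, at a subspace variable it does.
    have hB1 : ∀ {H₀ : Type} [NormedAddCommGroup H₀] [InnerProductSpace ℂ H₀] {V : Submodule ℂ H₀}
        {ρK : Representation ℂ (uFormGroup (Fin 2) (Fin 1)).maximalCompact V}
        {ρ𝔤 : (uFormGroup (Fin 2) (Fin 1)).lie →ₗ⁅ℝ⁆ Module.End ℂ V} {E : Submodule ℂ V},
        (∀ (X : (uFormGroup (Fin 2) (Fin 1)).lie) (a b : V), ⟪ρ𝔤 X a, b⟫_ℂ + ⟪a, ρ𝔤 X b⟫_ℂ = 0) →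
        (∀ e ∈ E, ∀ s : (Fin 2 × Fin 1) × Fin 2, pOp ρ𝔤 Complex.I (upqPBasis s) e = 0) →
        (∀ W ∈ (uFormGroup (Fin 2) (Fin 1)).kInLie, ∀ e ∈ E, ρ𝔤 W e ∈ E) →
        (∀ (k : (uFormGroup (Fin 2) (Fin 1)).maximalCompact), ∀ e ∈ E, ρK k e ∈ E) →
        (∀ e ∈ E, ρ𝔤 (upqZ0 (Fin 2) (Fin 1)) e = Complex.I • e) →
        (∀ F : Submodule ℂ V, F ≤ E → (∀ (k : (uFormGroup (Fin 2) (Fin 1)).maximalCompact), ∀ f ∈ F, ρK k f ∈ F) → F = ⊥ ∨ F = E) →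
        ∀ {W : Submodule ℂ V}, IsGKSubmodule ρK ρ𝔤 W → W ≤ gen ρ𝔤 Complex.I E → W = ⊥ ∨ W = gen ρ𝔤 Complex.I E :=
      fun hU hEn hEk hEK hw hEirr _ hW hWle => eq_bot_or_eq_gen_of_isGKSubmodule hU Complex.I_mul_I hEn hEk hEK hw hEirr hW hWle
    exact fun U' hU' hle => hB1 (inner_archRepLieCM_skew ι T hT P) hEn hEk hEK hw (hEirr v hv') hU' hle
  -- the Harish-Chandra core of `W_Φ` IS `gen`
  have hcg : W.toSubmodule.comap (P.archModuleCM ι T hT).subtype = gen (P.archRepLieCM ι T hT) Complex.I (Submodule.span ℂ (Set.range v)) :=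
    le_antisymm (fun x hx => hWU x hx) fun x hx =>
      (hW _).2 (Submodule.le_topologicalClosure _ (coe_mem_l2OfForms_of_mem_gen ι T hT P hΦ v hv hx))
  have hirr' : ∀ U' : Submodule ℂ (P.archModuleCM ι T hT), IsGKSubmodule (P.archRepKCM ι T hT) (P.archRepLieCM ι T hT) U' →
      U' ≤ W.toSubmodule.comap (P.archModuleCM ι T hT).subtype →
      U' = ⊥ ∨ U' = W.toSubmodule.comap (P.archModuleCM ι T hT).subtype := by
    rw [hcg]
    exact hirr
  intro _ _ _ hA hG hι' hfac
  exact archIsotypy_of_core' P (uFormGroup (Fin 2) (Fin 1)) (cmArchSectionUForm L ι H T hT) (continuous_cmArchSectionUForm L ι H T hT) W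
    (hcg ▸ hUne) hirr' (hadm v hv' _ hcg (core_le_comap_archRepK P _ _ W)) hA hG hι' hfac

end Summit.HodgeConjecture.HodgeConjecture.Cruxes.H413.F0P3HolFormArchIsotypy
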